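import Literature.NumberTheory.Automorphic.ShimuraCurveTakahashiCoordinateInputs
import Literature.NumberTheory.Automorphic.ShimuraParametrizationSplitDegreeProofs
import Literature.NumberTheory.Automorphic.ShimuraCurveDataExistence
import Literature.NumberTheory.EllipticCurves.TakahashiDegreeFormulaCoprimeProofs
import HarnessLib

/-!
# stub-ideation k1 g14 — `stub_takahashi` (crux stmt-ABC-11338, line `Sketch`) companion sketch

FAMILY 1 (recognise & import), TREE MATCH: the stub
`Literature.NumberTheory.EllipticCurves.takahashi2001_thm_2_3_of_coprime` is — up to the
conductor-restricted minimality idiom — the `D = 1` instance of the BSD-side print fact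
`Literature.NumberTheory.Automorphic.takahashi2001_thm_2_3_shimura_level`
(`ShimuraCurveTakahashiCoordinateInputs.lean`), through the PROVED split-case bridge
`X₀^1(N) = X₀(N)` WITH DEGREES (`ShimuraParametrizationSplitDegreeProofs.lean`:
`exists_shimuraParametrizationData_deg_eq_modularDegree`, `ShimuraParametrizationData.modularDegree_dvd_deg`)
and the PROVED existence of Shimura curve data (`nonempty_shimuraCurveData_holds`).

* `takahashiClassForm` — the isogeny-CLASS form of Thm 2.3 at `D = 1` (reference curve `W` of
  conductor `M r`, parametrised curve `W' ∼ W`, UNRESTRICTED newform-minimality).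
* `takahashiClassForm_of_shimura_level` — PROVED (H1): class form ⇐ the BSD print fact.
* `takahashi2001_thm_2_3_of_coprime_of_classForm_of_carayol` — PROVED (H2): the verbatim stub ⇐
  class form + Carayol `IsNewformOf.level_eq_conductorNorm` (named fact) at every level.
* `takahashi2001_thm_2_3_of_coprime_of_classForm_of_conductor` — PROVED (H2'): the verbatim stub ⇐
  class form + isogeny-invariance of the conductor.
* `stub_takahashi_of_shimura_level_of_carayol` — PROVED: the stub from the two named facts.
* `modularDegree_le_brandtXi_mul_of_classForm` — PROVED (H3): the corollary the lead's composition
  consumes, in class form (feeds `DefiniteRTControlPrime_of` at the lattice-optimal datum `(W₀, D₀)`,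
  making `exists_conductorMinimal` and the Carayol seam unnecessary).
-/

set_option linter.dupNamespace false

noncomputable section

namespace Summit.ABC.ABC.Cruxes.DefiniteRTControlPrime.StubIdeas1G14

open Literature.NumberTheory.EllipticCurves Literature.NumberTheory.EllipticCurves.ModularForms
open Literature.NumberTheory.Automorphic
open WeierstrassCurve

/-- **T′ — Takahashi 2001 Thm 2.3 at `r ∥ N`, isogeny-class form.** For `W/ℚ` of conductor
`N = M r` (`r` prime, `gcd(M, r) = 1`), any `W' ∼ W` and any datum `P` of `W'` at level `N` of
minimal degree among ALL data at level `N` with the newform `P.f` (the optimal quotient,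
`δ = δ_{1,N}`), and every Brandt setup `S` of type `(M, r)`: `δ i = ξ_S j`, `i j = c_r(W')`,
`i ∣ ξ_S`, `0 < i`. -/
def takahashiClassForm : Prop :=
  ∀ (W : WeierstrassCurve ℚ) [W.IsElliptic] (M r : ℕ) [NeZero (M * r)], r.Prime → M.Coprime r →
    W.conductorNorm ℤ = M * r →
    ∀ (W' : WeierstrassCurve ℚ) [W'.IsElliptic], W.IsIsogenous W' →
    ∀ P : ModularParametrizationData W' (M * r),
      (∀ (W'' : WeierstrassCurve ℚ) [W''.IsElliptic] (P'' : ModularParametrizationData W'' (M * r)),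
          P''.f = P.f → P.modularDegree ≤ P''.modularDegree) →
      ∀ S : Brandt.XiSetup M r,
        ∃ i j : ℕ, 0 < i ∧ i * j = (W'.minimalDiscriminantNorm ℤ).factorization r ∧
          i ∣ S.xi (fun n => W'.LFunction n) ∧
          P.modularDegree * i = S.xi (fun n => W'.LFunction n) * j

/-- **H1 (PROVED). The class form from the BSD-side print fact at `D = 1`.** Shimura curve data of
level `(1, M r)` exist (`nonempty_shimuraCurveData_holds`); `P` transports to `X₀^1(M r)` with its
degree (`exists_shimuraParametrizationData_deg_eq_modularDegree`); the transported datum is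
class-minimal because `δ_{1,N} ∣ deg P''` for every Shimura datum `P''` of the class
(`ShimuraParametrizationData.modularDegree_dvd_deg`); then `takahashi2001_thm_2_3_shimura_level`
with `D = 1`, `p = r`, `m = M`, reading the setup of type `(M, 1·r)` as one of type `(M, r)`. -/
theorem takahashiClassForm_of_shimura_level (h : takahashi2001_thm_2_3_shimura_level) :
    takahashiClassForm := by
  intro W _ M r _ hr hcop hN W' _ hiso P hmin S
  have hpos : 0 < M * r := Nat.pos_of_ne_zero (NeZero.ne _)
  obtain ⟨X⟩ := nonempty_shimuraCurveData_holds (isAdmissibleFactorization_one hpos)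
  obtain ⟨Psh, hdeg⟩ := exists_shimuraParametrizationData_deg_eq_modularDegree X P
  have hfW : IsNewformOf W P.f := P.isNewformOf.of_isIsogenous hiso
  have hminSh : Psh.IsMinimalFor W := by
    refine ⟨hiso, fun W'' _ P'' hiso'' => ?_⟩
    rw [hdeg]
    exact Nat.le_of_dvd P''.deg_pos (P''.modularDegree_dvd_deg hiso'' P hfW hmin)
  have hndvd : ¬ r ∣ M := by
    intro hrM
    have h1 : Nat.Coprime r r := hcop.coprime_dvd_left hrM
    exact hr.one_lt.ne' (by simpa using h1)
  have h1 := fun S' => h hr (mul_comm M r) hndvd (isAdmissibleFactorization_one hpos) X W hN W'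
    Psh hminSh S'
  rw [Nat.one_mul] at h1
  obtain ⟨i, j, hi, hij, hdvd, hδ⟩ := h1 S
  exact ⟨i, j, hi, hij, hdvd, hdeg ▸ hδ⟩

/-- **H2 (PROVED). The verbatim stub from the class form and Carayol's theorem** (named fact
`IsNewformOf.level_eq_conductorNorm`: a curve carrying a newform of level `N` has conductor `N`):
the stub's conductor-restricted minimality then implies the unrestricted one. -/
theorem takahashi2001_thm_2_3_of_coprime_of_classForm_of_carayol (hT : takahashiClassForm)
    (hCar : ∀ {N : ℕ} [NeZero N], IsNewformOf.level_eq_conductorNorm (N := N)) :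
    takahashi2001_thm_2_3_of_coprime := by
  intro W _ M r _ hr hcop hN P hmin S
  refine hT W M r hr hcop hN W (IsIsogenous.refl_holds W) P ?_ S
  intro W'' _ P'' hf
  have hcond : W''.conductorNorm ℤ = M * r := (hCar P''.isNewformOf).symm
  exact hmin W'' hcond P'' hf

/-- **H2′ (PROVED). The verbatim stub from the class form and the isogeny-invariance of the
conductor** (in the tree: `conductorNorm_eq_of_isIsogenous_of_modularity`, granted modularity, or
`conductorNorm_eq_of_isIsogenous_of_tate`, granted Ogg–Saito): curves carrying data with the same
newform are `ℚ`-isogenous (Faltings, tree theorem `isIsogenous_iff_frobeniusTrace_eq_holds`). -/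
theorem takahashi2001_thm_2_3_of_coprime_of_classForm_of_conductor (hT : takahashiClassForm)
    (hCond : ∀ (V V' : WeierstrassCurve ℚ) [V.IsElliptic] [V'.IsElliptic],
      V.IsIsogenous V' → V.conductorNorm ℤ = V'.conductorNorm ℤ) :
    takahashi2001_thm_2_3_of_coprime := by
  intro W _ M r _ hr hcop hN P hmin S
  refine hT W M r hr hcop hN W (IsIsogenous.refl_holds W) P ?_ S
  intro W'' _ P'' hf
  have hP'' : IsNewformOf W'' P.f := hf ▸ P''.isNewformOf
  have hiso : W.IsIsogenous W'' :=
    IsNewformOf.isIsogenous WeierstrassCurve.isIsogenous_iff_frobeniusTrace_eq_holds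
      P.isNewformOf hP''
  have hcond : W''.conductorNorm ℤ = M * r := (hCond W W'' hiso).symm.trans hN
  exact hmin W'' hcond P'' hf

/-- **The stub from the two named facts** (BSD print fact + Carayol). -/
theorem stub_takahashi_of_shimura_level_of_carayol (h : takahashi2001_thm_2_3_shimura_level)
    (hCar : ∀ {N : ℕ} [NeZero N], IsNewformOf.level_eq_conductorNorm (N := N)) :
    takahashi2001_thm_2_3_of_coprime :=
  takahashi2001_thm_2_3_of_coprime_of_classForm_of_carayol (takahashiClassForm_of_shimura_level h)
    hCar

/-- **H3 (PROVED). `δ ≤ ξ(M, r)(a(W')) · ord_r Δ_min(W')` in class form** — the shape the lead's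
composition `DefiniteRTControlPrime_of` consumes (there via
`takahashi2001_thm_2_3_of_coprime.modularDegree_le_brandtXi_mul` at the conductor-restricted pivot
`(W⋆, P⋆)`; here at ANY class member, e.g. the lattice-optimal datum `(W₀, D₀)` of
`exists_optimalDatum'`, whose unrestricted minimality `hmin₀` the skeleton already proves). -/
theorem modularDegree_le_brandtXi_mul_of_classForm (hT : takahashiClassForm)
    (W : WeierstrassCurve ℚ) [W.IsElliptic] (M r : ℕ) [NeZero (M * r)] (hr : r.Prime)
    (hcop : M.Coprime r) (hN : W.conductorNorm ℤ = M * r) (W' : WeierstrassCurve ℚ) [W'.IsElliptic]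
    (hiso : W.IsIsogenous W') (P : ModularParametrizationData W' (M * r))
    (hmin : ∀ (W'' : WeierstrassCurve ℚ) [W''.IsElliptic]
      (P'' : ModularParametrizationData W'' (M * r)), P''.f = P.f → P.modularDegree ≤ P''.modularDegree) :
    P.modularDegree ≤
      brandtXi M r (fun n => W'.LFunction n) * (W'.minimalDiscriminantNorm ℤ).factorization r := by
  obtain ⟨S, hS⟩ := exists_brandtXi_eq (takahashi2001_thm_2_3_of_coprime.nonempty_xiSetup' hr hcop)
    (fun n => W'.LFunction n)
  rw [hS]
  obtain ⟨i, j, hi, hij, -, hδ⟩ := hT W M r hr hcop hN W' hiso P hmin S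
  calc P.modularDegree ≤ P.modularDegree * i := Nat.le_mul_of_pos_right _ hi
    _ = S.xi (fun n => W'.LFunction n) * j := hδ
    _ ≤ S.xi (fun n => W'.LFunction n) * (i * j) :=
        Nat.mul_le_mul_left _ (Nat.le_mul_of_pos_left _ hi)
    _ = _ := by rw [hij]

/-- **The same from the BSD print fact alone** (no Carayol): what the lead's composition needs. -/
theorem modularDegree_le_brandtXi_mul_of_shimura_level (h : takahashi2001_thm_2_3_shimura_level)
    (W : WeierstrassCurve ℚ) [W.IsElliptic] (M r : ℕ) [NeZero (M * r)] (hr : r.Prime)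
    (hcop : M.Coprime r) (hN : W.conductorNorm ℤ = M * r) (W' : WeierstrassCurve ℚ) [W'.IsElliptic]
    (hiso : W.IsIsogenous W') (P : ModularParametrizationData W' (M * r))
    (hmin : ∀ (W'' : WeierstrassCurve ℚ) [W''.IsElliptic]
      (P'' : ModularParametrizationData W'' (M * r)), P''.f = P.f → P.modularDegree ≤ P''.modularDegree) :
    P.modularDegree ≤
      brandtXi M r (fun n => W'.LFunction n) * (W'.minimalDiscriminantNorm ℤ).factorization r :=
  modularDegree_le_brandtXi_mul_of_classForm (takahashiClassForm_of_shimura_level h) W M r hr hcop hN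
    W' hiso P hmin

end Summit.ABC.ABC.Cruxes.DefiniteRTControlPrime.StubIdeas1G14

end
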